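import Literature.MathematicalPhysics.QuantumFieldTheory.Balaban1983to89.Beta.TwoPowerLegs

/-!
# `BalabanUV.Beta.FP.PerfectPropagatorLegDataInvSq` — road «FP» for binder row D1, leaf (H2) of the horizontal route, row **H2-ASM-2** (H2V-DESIGN §4,
# R-FP-23; `LEAVES-FP.md` l.323), PART 1a [folklore]: LATTICE DIFFERENCES OF THE CONTINUUM LEG `|x|⁻²` ON `ℤ⁴` — the quadratic Taylor polynomial, whose
# second lattice difference IS the Hessian entry and whose third lattice difference VANISHES, hence `Δ_μΔ_ν|x|⁻² = ∂_μ∂_ν|x|⁻² + O(‖w‖∞⁻⁵)` for EVERY pair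
# `(μ, ν)` and `Δ_kΔ_μΔ_ν|x|⁻² = O(‖w‖∞⁻⁵)`; plus the far-field ⟹ all-`w` conversion used by PARTS 1b∕2.

HONEST DEPENDENCY (page 1, mandatory): continuum YM on T⁴ ⇐ BetaPertH ∧ nine spine estimates (0/9 proved); BetaPertH ⇐ (D1) ∧ (D4) ∧ CAP+tail;
G-an2-4 gates asym, D1 and NE2/3/4.  HONEST FRAMING (cell contract, verbatim): «discharging `BetaPertH` makes Bałaban's UV stability UNCONDITIONAL —
a real constructive-QFT result; it is NOT the continuum limit and NOT the Clay problem.»  THIS MODULE DISCHARGES NOTHING of the wall: [folklore] lattice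
Taylor bookkeeping over an3-g5's `TwoPowerLegs` (`taylor2_invSq`, `taylor3_invSq`, `sum_toReal_unitVec_mul`, `sum_sum_toReal_unitVec_mul`) for the explicit
rational functions `invSq`∕`d1InvSq`∕`hessInvSq` of `BubbleTransfer` §1.  Three auxiliary [folklore] algebraic defs (`linX`, `bilX`, `tq`: the linear ∕ bilinear
Taylor parts and the quadratic Taylor polynomial); 0 `def … : Prop`; nothing cited; 0 sorry; 0 wall binders; NOT `hgerm`, NOT D1, NOT BetaPertH, NOT continuum,
NOT Clay.  «not in print as used here; our bookkeeping».

ABSOLUTE RULE (cell charter, verbatim): «No internally-minted statement may enter as a cited fact. Every hypothesis is either kernel-proved in this package or a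
verbatim quotation of a PUBLISHED theorem with page reference. The manuscript(s) under audit are NOT citable for their own disputed steps — they are the thing
under adjudication; programme-internal (2001/route/tribunal) claims are never citable.»

WHAT (`w ∈ ℤ⁴ = DyadicShell.Pt`, `‖w‖∞ = supNorm w`, `e_μ = BubbleTransfer.unitVec μ`, `X = toReal w`):
* §1 [folklore] `abs_le_inv_succ_pow_of_far` (bounded by `M` everywhere + `≤ A∕‖w‖∞^a` for `m ≤ ‖w‖∞`, `1 ≤ m` ⟹ `≤ (2^a·A + (m+1)^a·M)∕(‖w‖∞+1)^a`
  everywhere), `norm_toReal_unitVec`, `half_le_supNorm_add_of`, `div_pow_five_shift_le`.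
* §2 [folklore] `linX`, `bilX`, `tq` and their algebra: `linX_add`, `bilX_add_left∕right`, `bilX_symm`, `tq_zero`, `abs_invSq_sub_tq_le` (= `taylor3_invSq`),
  **`tq_diff2`** (`tq(u+v) − tq u − tq v + tq 0 = bilX u v`), **`tq_diff3`** (the third difference of `tq` is `0`), `bilX_unitVec`, `linX_unitVec`.
* §3 [folklore] `abs_corner_le`; **`abs_diff2_invSq_sub_hess_le`** (`4 ≤ ‖w‖∞`, EVERY `μ ν`: `|Δ_μΔ_ν|X|⁻² − ∂_μ∂_ν|X|⁻²| ≤ 89088∕‖w‖∞⁵`);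
  **`abs_diff3_invSq_le`** (`6 ≤ ‖w‖∞`: `|Δ_kΔ_μΔ_ν|X|⁻²| ≤ 701568∕‖w‖∞⁵`); `abs_diff1_invSq_sub_d1_le` (`2 ≤ ‖w‖∞`: `≤ 112∕‖w‖∞⁴`).
Consumers: PART 1b `FP/PerfectPropagatorLegDataFree` (any `TwoPower` family with sharp differences; the free leg), PART 2 `FP/PerfectPropagatorLegData`.

Provenance: binder row D1 formalisation swarm, lineage beta-d1-formalise-leaf-01, gen 9 (prover-b2b-balaban-beta-d1-formalise-leaf-01-g9-0), 2026-08-20;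
road FP (owner b2b-balaban-beta-d1-p3, H2V-DESIGN f78878bd5f8d2d18), row H2-ASM-2; INTENT ∕ CLAIM journal l.23258.
-/

noncomputable section

namespace Summit.QuantumFields.BalabanUV.Beta.FP.PerfectPropagatorLegDataInvSq

open Finset
open scoped BigOperators
open Literature.MathematicalPhysics.QuantumFieldTheory.Balaban1983to89.Beta
open Literature.MathematicalPhysics.QuantumFieldTheory.Balaban1983to89.Beta.TransverseStructure
open Literature.MathematicalPhysics.QuantumFieldTheory.Balaban1983to89.Beta.LeadingCoefficient
open Literature.MathematicalPhysics.QuantumFieldTheory.Balaban1983to89.Beta.DyadicShell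
open Literature.MathematicalPhysics.QuantumFieldTheory.Balaban1983to89.Beta.BubbleTransfer
open Literature.MathematicalPhysics.QuantumFieldTheory.Balaban1983to89.Beta.TwoPowerLegs

/-! ## §1 Far-field bounds ⟹ all-`w` letters; shifted-point norms -/

/-- [folklore] **FAR FIELD ⟹ ALL `w`**: if `|f w| ≤ M` everywhere and `|f w| ≤ A∕‖w‖∞^a` for `m ≤ ‖w‖∞` (`1 ≤ m`, `0 ≤ A`, `0 ≤ M`), then
`|f w| ≤ (2^a·A + (m+1)^a·M)∕(‖w‖∞+1)^a` for every `w`. -/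
theorem abs_le_inv_succ_pow_of_far {f : Pt → ℝ} {A M : ℝ} {a m : ℕ} (hA : 0 ≤ A) (hM : 0 ≤ M) (hm : 1 ≤ m)
    (h0 : ∀ w, |f w| ≤ M) (h1 : ∀ w, m ≤ supNorm w → |f w| ≤ A / (supNorm w : ℝ) ^ a) (w : Pt) :
    |f w| ≤ (2 ^ a * A + ((m : ℝ) + 1) ^ a * M) / ((supNorm w : ℝ) + 1) ^ a := by
  set s : ℝ := (supNorm w : ℝ) with hs
  have hs0 : 0 ≤ s := by positivity
  have hden : 0 < (s + 1) ^ a := by positivity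
  rw [le_div_iff₀ hden]
  by_cases hfar : m ≤ supNorm w
  · have hs1 : (1 : ℝ) ≤ s := by rw [hs]; exact_mod_cast (le_trans hm hfar)
    have hspos : 0 < s := by linarith
    have hf := h1 w hfar
    have h2 : (s + 1) ^ a ≤ 2 ^ a * s ^ a := by
      rw [← mul_pow]; exact pow_le_pow_left₀ (by linarith) (by linarith) a
    calc |f w| * (s + 1) ^ a ≤ A / s ^ a * (2 ^ a * s ^ a) := mul_le_mul hf h2 hden.le (div_nonneg hA (pow_nonneg hs0 _))
      _ = 2 ^ a * A := by field_simp
      _ ≤ 2 ^ a * A + ((m : ℝ) + 1) ^ a * M := by nlinarith [pow_nonneg (show (0 : ℝ) ≤ (m : ℝ) + 1 by positivity) a]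
  · push Not at hfar
    have hsm : s + 1 ≤ (m : ℝ) + 1 := by
      rw [hs]; have : (supNorm w : ℝ) ≤ m := by exact_mod_cast hfar.le
      linarith
    have h2 : (s + 1) ^ a ≤ ((m : ℝ) + 1) ^ a := pow_le_pow_left₀ (by linarith) hsm a
    calc |f w| * (s + 1) ^ a ≤ M * ((m : ℝ) + 1) ^ a := mul_le_mul (h0 w) h2 hden.le hM
      _ = ((m : ℝ) + 1) ^ a * M := by ring
      _ ≤ 2 ^ a * A + ((m : ℝ) + 1) ^ a * M := by nlinarith [pow_nonneg (show (0 : ℝ) ≤ 2 by norm_num) a]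

/-- [folklore] `‖toReal (e_μ)‖ = 1`. -/
theorem norm_toReal_unitVec (μ : Fin 4) : ‖toReal (unitVec μ)‖ = 1 := by
  rw [norm_toReal, supNorm_unitVec]; norm_num

/-- [folklore] a shift by `α` with `‖α‖∞ ≤ r`, `2r ≤ ‖w‖∞` keeps half the norm: `‖w‖∞∕2 ≤ ‖w + α‖∞`. -/
theorem half_le_supNorm_add_of {w α : Pt} {r : ℝ} (hα : (supNorm α : ℝ) ≤ r) (hw : 2 * r ≤ supNorm w) :
    (supNorm w : ℝ) / 2 ≤ supNorm (w + α) := by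
  have := supNorm_sub_le_supNorm_add w α
  linarith

/-- [folklore] far-field comparison: `A∕t⁵ ≤ 32·A∕s⁵` when `s∕2 ≤ t`, `0 < s`, `0 ≤ A`. -/
theorem div_pow_five_shift_le {A : ℝ} (hA : 0 ≤ A) {s t : ℝ} (hs : 0 < s) (ht : s / 2 ≤ t) :
    A / t ^ 5 ≤ 32 * A / s ^ 5 := by
  have ht0 : 0 < t := by linarith
  rw [div_le_div_iff₀ (pow_pos ht0 5) (pow_pos hs 5)]
  have h5 : s ^ 5 ≤ 32 * t ^ 5 := by
    have := pow_le_pow_left₀ (by linarith) ht 5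
    nlinarith
  nlinarith

/-! ## §2 The quadratic Taylor polynomial of `|x|⁻²` and its lattice differences -/

/-- [folklore] the linear Taylor part `Σ_μ ζ_μ·∂_μ|X|⁻²`. -/
def linX (X ζ : E4) : ℝ := ∑ μ, ζ μ * d1InvSq μ X

/-- [folklore] the bilinear Taylor part `Σ_{a,b} x_a y_b·∂_a∂_b|X|⁻²`. -/
def bilX (X x y : E4) : ℝ := ∑ a, ∑ b, x a * y b * hessInvSq a b X

/-- [folklore] the quadratic Taylor polynomial `tq X ζ = |X|⁻² + linX X ζ + ½·bilX X ζ ζ`. -/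
def tq (X ζ : E4) : ℝ := invSq X + linX X ζ + (1 / 2) * bilX X ζ ζ

/-- [folklore] additivity of the linear part. -/
theorem linX_add (X x y : E4) : linX X (x + y) = linX X x + linX X y := by
  unfold linX; rw [← Finset.sum_add_distrib]; exact Finset.sum_congr rfl fun μ _ => by simp only [Pi.add_apply]; ring

/-- [folklore] `linX X 0 = 0`. -/
theorem linX_zero (X : E4) : linX X 0 = 0 := by simp [linX]

/-- [folklore] additivity of the bilinear part in the first slot. -/
theorem bilX_add_left (X x y t : E4) : bilX X (x + y) t = bilX X x t + bilX X y t := by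
  unfold bilX; rw [← Finset.sum_add_distrib]
  refine Finset.sum_congr rfl fun a _ => ?_
  rw [← Finset.sum_add_distrib]
  exact Finset.sum_congr rfl fun b _ => by simp only [Pi.add_apply]; ring

/-- [folklore] additivity of the bilinear part in the second slot. -/
theorem bilX_add_right (X t x y : E4) : bilX X t (x + y) = bilX X t x + bilX X t y := by
  unfold bilX; rw [← Finset.sum_add_distrib]
  refine Finset.sum_congr rfl fun a _ => ?_
  rw [← Finset.sum_add_distrib]
  exact Finset.sum_congr rfl fun b _ => by simp only [Pi.add_apply]; ring

/-- [folklore] symmetry of the bilinear part (`hessInvSq_symm`). -/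
theorem bilX_symm (X x y : E4) : bilX X x y = bilX X y x := by
  unfold bilX; rw [Finset.sum_comm]
  exact Finset.sum_congr rfl fun a _ => Finset.sum_congr rfl fun b _ => by rw [hessInvSq_symm b a]; ring

/-- [folklore] `bilX X 0 t = 0`. -/
theorem bilX_zero_left (X t : E4) : bilX X 0 t = 0 := by simp [bilX]

/-- [folklore] `tq X 0 = |X|⁻²`. -/
theorem tq_zero (X : E4) : tq X 0 = invSq X := by simp [tq, linX_zero, bilX_zero_left]

/-- [folklore] `taylor3_invSq` in the `tq` currency: `|1∕|X+ζ|² − tq X ζ| ≤ 3712‖ζ‖³∕‖X‖⁵` for `X ≠ 0`, `2‖ζ‖ ≤ ‖X‖`. -/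
theorem abs_invSq_sub_tq_le {X ζ : E4} (hX : X ≠ 0) (h : 2 * ‖ζ‖ ≤ ‖X‖) : |invSq (X + ζ) - tq X ζ| ≤ 3712 * ‖ζ‖ ^ 3 / ‖X‖ ^ 5 := by
  have h3 := taylor3_invSq hX h
  have e : invSq (X + ζ) - tq X ζ = invSq (X + ζ) - invSq X - ∑ μ, ζ μ * d1InvSq μ X - (1 / 2) * ∑ a, ∑ b, ζ a * ζ b * hessInvSq a b X := by
    simp only [tq, linX, bilX]; ring
  rw [e]; exact h3

/-- [folklore] **THE SECOND DIFFERENCE OF THE TAYLOR POLYNOMIAL IS THE BILINEAR ENTRY**: `tq(u+v) − tq u − tq v + tq 0 = bilX u v`. -/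
theorem tq_diff2 (X u v : E4) : tq X (u + v) - tq X u - tq X v + tq X 0 = bilX X u v := by
  simp only [tq, linX_add, linX_zero, bilX_add_left, bilX_add_right, bilX_zero_left, bilX_symm X v u]
  ring

/-- [folklore] **THE THIRD DIFFERENCE OF THE TAYLOR POLYNOMIAL VANISHES**. -/
theorem tq_diff3 (X u v t : E4) :
    tq X (u + v + t) - tq X (u + v) - tq X (u + t) - tq X (v + t) + tq X u + tq X v + tq X t - tq X 0 = 0 := by
  simp only [tq, linX_add, linX_zero, bilX_add_left, bilX_add_right, bilX_zero_left, bilX_symm X v u, bilX_symm X t u, bilX_symm X t v]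
  ring

/-- [folklore] `bilX X e_μ e_ν = ∂_μ∂_ν|X|⁻²`. -/
theorem bilX_unitVec (X : E4) (μ ν : Fin 4) : bilX X (toReal (unitVec μ)) (toReal (unitVec ν)) = hessInvSq μ ν X := by
  unfold bilX; exact sum_sum_toReal_unitVec_mul ν μ (fun a b => hessInvSq a b X)

/-- [folklore] `linX X e_i = ∂_i|X|⁻²`. -/
theorem linX_unitVec (X : E4) (i : Fin 4) : linX X (toReal (unitVec i)) = d1InvSq i X := by
  unfold linX; exact sum_toReal_unitVec_mul i (fun μ => d1InvSq μ X)

/-! ## §3 Lattice differences of `|x|⁻²` on `ℤ⁴` -/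

section InvSq

variable {w : Pt}

/-- [folklore] the Taylor remainder at a lattice increment `ζ` with `‖ζ‖∞ ≤ r`, `2r ≤ ‖w‖∞`, `w ≠ 0`: `|invSq (X + ζ) − tq X ζ| ≤ 3712·r³∕‖w‖∞⁵`. -/
theorem abs_corner_le {ζ : Pt} {r : ℝ} (hζ : (supNorm ζ : ℝ) ≤ r) (hw : 2 * r ≤ supNorm w) (hw0 : w ≠ 0) :
    |invSq (toReal w + toReal ζ) - tq (toReal w) (toReal ζ)| ≤ 3712 * r ^ 3 / (supNorm w : ℝ) ^ 5 := by
  have hX0 : toReal w ≠ 0 := fun h => hw0 (toReal_eq_zero_iff.mp h)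
  have h := abs_invSq_sub_tq_le (X := toReal w) (ζ := toReal ζ) hX0 (by rw [norm_toReal, norm_toReal]; linarith)
  rw [norm_toReal, norm_toReal] at h
  have hs : (0 : ℝ) < supNorm w := by have := Leg.one_le_supNorm hw0; linarith
  refine h.trans (div_le_div_of_nonneg_right ?_ (by positivity))
  have h3 : (supNorm ζ : ℝ) ^ 3 ≤ r ^ 3 := pow_le_pow_left₀ (by positivity) hζ 3
  nlinarith

/-- [folklore] `‖e_μ + e_ν‖∞ ≤ 2` (real form). -/
theorem supNorm_unitVec_add_le (μ ν : Fin 4) : (supNorm (unitVec μ + unitVec ν) : ℝ) ≤ 2 := by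
  rw [← norm_toReal, toReal_add]
  refine (norm_add_le _ _).trans ?_
  rw [norm_toReal_unitVec, norm_toReal_unitVec]; norm_num

/-- [folklore] `‖e_k + e_μ + e_ν‖∞ ≤ 3` (real form). -/
theorem supNorm_unitVec_add3_le (k μ ν : Fin 4) : (supNorm (unitVec k + unitVec μ + unitVec ν) : ℝ) ≤ 3 := by
  rw [← norm_toReal, toReal_add, toReal_add]
  refine (norm_add_le _ _).trans ?_
  refine (add_le_add (norm_add_le _ _) le_rfl).trans ?_
  rw [norm_toReal_unitVec, norm_toReal_unitVec, norm_toReal_unitVec]; norm_num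

/-- [folklore] **SECOND DIFFERENCES OF `|x|⁻²` vs THE HESSIAN ENTRY, EVERY PAIR `(μ, ν)`** (`4 ≤ ‖w‖∞`):
`|invSq(w+e_μ+e_ν) − invSq(w+e_μ) − invSq(w+e_ν) + invSq(w) − ∂_μ∂_ν|X|⁻²| ≤ 89088∕‖w‖∞⁵` (three Taylor remainders; the polynomial's second
difference IS the entry — diagonal and mixed alike). -/
theorem abs_diff2_invSq_sub_hess_le (μ ν : Fin 4) (hw : 4 ≤ supNorm w) :
    |invSq (toReal (w + unitVec μ + unitVec ν)) - invSq (toReal (w + unitVec μ)) - invSq (toReal (w + unitVec ν)) + invSq (toReal w)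
        - hessInvSq μ ν (toReal w)| ≤ 89088 / (supNorm w : ℝ) ^ 5 := by
  have hw0 : w ≠ 0 := by intro h; rw [h, supNorm_eq_zero_iff.mpr rfl] at hw; omega
  have hs4 : (4 : ℝ) ≤ supNorm w := by exact_mod_cast hw
  have n1 : (supNorm (unitVec μ) : ℝ) ≤ 2 := by rw [supNorm_unitVec]; norm_num
  have n2 : (supNorm (unitVec ν) : ℝ) ≤ 2 := by rw [supNorm_unitVec]; norm_num
  have c12 := abs_corner_le (supNorm_unitVec_add_le μ ν) (by linarith) hw0
  have c1 := abs_corner_le n1 (by linarith) hw0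
  have c2 := abs_corner_le n2 (by linarith) hw0
  have hpoly := tq_diff2 (toReal w) (toReal (unitVec μ)) (toReal (unitVec ν))
  rw [bilX_unitVec, tq_zero, ← toReal_add] at hpoly
  have e1 : toReal (w + unitVec μ + unitVec ν) = toReal w + toReal (unitVec μ + unitVec ν) := by rw [add_assoc, toReal_add]
  rw [e1, toReal_add w (unitVec μ), toReal_add w (unitVec ν)]
  have e : invSq (toReal w + toReal (unitVec μ + unitVec ν)) - invSq (toReal w + toReal (unitVec μ)) - invSq (toReal w + toReal (unitVec ν))
        + invSq (toReal w) - hessInvSq μ ν (toReal w)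
      = (invSq (toReal w + toReal (unitVec μ + unitVec ν)) - tq (toReal w) (toReal (unitVec μ + unitVec ν)))
        - (invSq (toReal w + toReal (unitVec μ)) - tq (toReal w) (toReal (unitVec μ)))
        - (invSq (toReal w + toReal (unitVec ν)) - tq (toReal w) (toReal (unitVec ν))) := by
    linear_combination hpoly
  rw [e]
  have b12 := abs_le.mp c12; have b1 := abs_le.mp c1; have b2 := abs_le.mp c2
  have hsum : |(invSq (toReal w + toReal (unitVec μ + unitVec ν)) - tq (toReal w) (toReal (unitVec μ + unitVec ν)))
        - (invSq (toReal w + toReal (unitVec μ)) - tq (toReal w) (toReal (unitVec μ)))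
        - (invSq (toReal w + toReal (unitVec ν)) - tq (toReal w) (toReal (unitVec ν)))|
      ≤ 3712 * 2 ^ 3 / (supNorm w : ℝ) ^ 5 + 3712 * 2 ^ 3 / (supNorm w : ℝ) ^ 5 + 3712 * 2 ^ 3 / (supNorm w : ℝ) ^ 5 := by
    rw [abs_le]; constructor <;> linarith [b12.1, b12.2, b1.1, b1.2, b2.1, b2.2]
  exact hsum.trans (le_of_eq (by ring))

/-- [folklore] **THIRD DIFFERENCES OF `|x|⁻²`** (`6 ≤ ‖w‖∞`): `|Δ_kΔ_μΔ_ν|X|⁻²| ≤ 701568∕‖w‖∞⁵` (seven Taylor remainders; the polynomial's third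
difference vanishes). -/
theorem abs_diff3_invSq_le (k μ ν : Fin 4) (hw : 6 ≤ supNorm w) :
    |invSq (toReal (w + unitVec k + unitVec μ + unitVec ν)) - invSq (toReal (w + unitVec k + unitVec μ))
        - invSq (toReal (w + unitVec k + unitVec ν)) - invSq (toReal (w + unitVec μ + unitVec ν))
        + invSq (toReal (w + unitVec k)) + invSq (toReal (w + unitVec μ)) + invSq (toReal (w + unitVec ν)) - invSq (toReal w)|
      ≤ 701568 / (supNorm w : ℝ) ^ 5 := by
  have hw0 : w ≠ 0 := by intro h; rw [h, supNorm_eq_zero_iff.mpr rfl] at hw; omega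
  have hs6 : (6 : ℝ) ≤ supNorm w := by exact_mod_cast hw
  -- the seven corners, each with increment of norm ≤ 3
  have cor : ∀ ζ : Pt, (supNorm ζ : ℝ) ≤ 3 →
      |invSq (toReal w + toReal ζ) - tq (toReal w) (toReal ζ)| ≤ 3712 * 3 ^ 3 / (supNorm w : ℝ) ^ 5 :=
    fun ζ h => abs_corner_le h (by linarith) hw0
  have le13 : ∀ κ : Fin 4, (supNorm (unitVec κ) : ℝ) ≤ 3 := fun κ => by rw [supNorm_unitVec]; norm_num
  have le23 : ∀ κ κ' : Fin 4, (supNorm (unitVec κ + unitVec κ') : ℝ) ≤ 3 := fun κ κ' => (supNorm_unitVec_add_le κ κ').trans (by norm_num)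
  have c7 := cor _ (supNorm_unitVec_add3_le k μ ν)
  have c6 := cor _ (le23 k μ); have c5 := cor _ (le23 k ν); have c4' := cor _ (le23 μ ν)
  have c3 := cor _ (le13 k); have c2 := cor _ (le13 μ); have c1 := cor _ (le13 ν)
  -- the polynomial identity, in lattice increments
  have hpoly := tq_diff3 (toReal w) (toReal (unitVec k)) (toReal (unitVec μ)) (toReal (unitVec ν))
  rw [tq_zero, ← toReal_add, ← toReal_add, ← toReal_add, ← toReal_add] at hpoly
  -- rewrite the corners of the goal
  have e7 : toReal (w + unitVec k + unitVec μ + unitVec ν) = toReal w + toReal (unitVec k + unitVec μ + unitVec ν) := by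
    rw [add_assoc, add_assoc, toReal_add, ← add_assoc]
  have e6 : toReal (w + unitVec k + unitVec μ) = toReal w + toReal (unitVec k + unitVec μ) := by rw [add_assoc, toReal_add]
  have e5 : toReal (w + unitVec k + unitVec ν) = toReal w + toReal (unitVec k + unitVec ν) := by rw [add_assoc, toReal_add]
  have e4 : toReal (w + unitVec μ + unitVec ν) = toReal w + toReal (unitVec μ + unitVec ν) := by rw [add_assoc, toReal_add]
  rw [e7, e6, e5, e4, toReal_add w (unitVec k), toReal_add w (unitVec μ), toReal_add w (unitVec ν)]
  have e : invSq (toReal w + toReal (unitVec k + unitVec μ + unitVec ν)) - invSq (toReal w + toReal (unitVec k + unitVec μ))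
        - invSq (toReal w + toReal (unitVec k + unitVec ν)) - invSq (toReal w + toReal (unitVec μ + unitVec ν))
        + invSq (toReal w + toReal (unitVec k)) + invSq (toReal w + toReal (unitVec μ)) + invSq (toReal w + toReal (unitVec ν)) - invSq (toReal w)
      = (invSq (toReal w + toReal (unitVec k + unitVec μ + unitVec ν)) - tq (toReal w) (toReal (unitVec k + unitVec μ + unitVec ν)))
        - (invSq (toReal w + toReal (unitVec k + unitVec μ)) - tq (toReal w) (toReal (unitVec k + unitVec μ)))
        - (invSq (toReal w + toReal (unitVec k + unitVec ν)) - tq (toReal w) (toReal (unitVec k + unitVec ν)))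
        - (invSq (toReal w + toReal (unitVec μ + unitVec ν)) - tq (toReal w) (toReal (unitVec μ + unitVec ν)))
        + (invSq (toReal w + toReal (unitVec k)) - tq (toReal w) (toReal (unitVec k)))
        + (invSq (toReal w + toReal (unitVec μ)) - tq (toReal w) (toReal (unitVec μ)))
        + (invSq (toReal w + toReal (unitVec ν)) - tq (toReal w) (toReal (unitVec ν))) := by
    linear_combination hpoly
  rw [e]
  have b7 := abs_le.mp c7; have b6 := abs_le.mp c6; have b5 := abs_le.mp c5; have b4 := abs_le.mp c4'
  have b3 := abs_le.mp c3; have b2 := abs_le.mp c2; have b1 := abs_le.mp c1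
  have h7 : (701568 : ℝ) / (supNorm w : ℝ) ^ 5 = 7 * (3712 * 3 ^ 3 / (supNorm w : ℝ) ^ 5) := by ring
  rw [h7, abs_le]
  constructor <;> linarith [b7.1, b7.2, b6.1, b6.2, b5.1, b5.2, b4.1, b4.2, b3.1, b3.2, b2.1, b2.2, b1.1, b1.2]

/-- [folklore] first differences of `|x|⁻²` vs the first partial (`2 ≤ ‖w‖∞`): `|invSq(w+e_i) − invSq(w) − ∂_i|X|⁻²| ≤ 112∕‖w‖∞⁴`. -/
theorem abs_diff1_invSq_sub_d1_le (i : Fin 4) (hw : 2 ≤ supNorm w) :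
    |invSq (toReal (w + unitVec i)) - invSq (toReal w) - d1InvSq i (toReal w)| ≤ 112 / (supNorm w : ℝ) ^ 4 := by
  have hw0 : w ≠ 0 := by intro h; rw [h, supNorm_eq_zero_iff.mpr rfl] at hw; omega
  have hX0 : toReal w ≠ 0 := fun h => hw0 (toReal_eq_zero_iff.mp h)
  have hs2 : (2 : ℝ) ≤ supNorm w := by exact_mod_cast hw
  have h := taylor2_invSq (X := toReal w) (ζ := toReal (unitVec i)) hX0 (by rw [norm_toReal_unitVec, norm_toReal]; linarith)
  rw [norm_toReal_unitVec, norm_toReal, ← toReal_add, sum_toReal_unitVec_mul i (fun μ => d1InvSq μ (toReal w))] at h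
  simpa using h

end InvSq

end Summit.QuantumFields.BalabanUV.Beta.FP.PerfectPropagatorLegDataInvSq

end
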